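import Mathlib
import HarnessLib

/-!
# The dual-side Schoenberg limit against one character (stub `stub_schoenbergLimit`)

Support lemma for the birth skeleton of the crux
`BECInfDivCoherence.GridInfDivCoherence` (item stmt-AtomisticToContinuum-9114).

For a finite index type, positive reals `F_j`, real weights `c_j` with `Σ_j c_j = 0`, a scale
`s > 0` and `ε ∈ ℝ`: if `(Σ_j F_j^t c_j)/s ≥ −ε t` for every `t ∈ (0,1]`, then
`(Σ_j log F_j · c_j)/s ≥ −ε`.

Proof: since `Σ c = 0`, `Σ_j F_j^t c_j = Σ_j (F_j^t − 1) c_j`; dividing the hypothesis by `t > 0`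
gives `−ε ≤ (Σ_j ((F_j^t − 1)/t) c_j)/s` for `t ∈ (0,1]`. As `t → 0⁺`, `(F^t − 1)/t → log F`
(the derivative of `t ↦ F^t` at `0`, `Real.hasStrictDerivAt_const_rpow`), finite sums pass to the
limit, and non-strict inequalities are preserved along the non-trivial filter `𝓝[>] 0`
(`ge_of_tendsto`).
-/

namespace Summit.AtomisticToContinuum.BoseEinsteinCondensation.Theorems

open Filter Topology

/-- The right derivative of `t ↦ a^t` at `0` as a slope limit: `(a^t − 1)/t → log a` as
`t → 0⁺`, for `a > 0`. [folklore] -/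
theorem tendsto_rpow_sub_one_div_nhdsGT {a : ℝ} (ha : 0 < a) :
    Tendsto (fun t : ℝ => (a ^ t - 1) / t) (𝓝[>] 0) (𝓝 (Real.log a)) := by
  have hd : HasDerivAt (fun x : ℝ => a ^ x) (Real.log a) 0 := by
    simpa using (Real.hasStrictDerivAt_const_rpow ha 0).hasDerivAt
  refine hd.tendsto_slope_zero_right.congr fun t => ?_
  simp only [zero_add, Real.rpow_zero, smul_eq_mul]
  rw [div_eq_inv_mul]

/-- **Dual-side Schoenberg limit against one character, with tolerance.** For a finite index
type, positive reals `F_j`, real weights `c_j` with `Σ_j c_j = 0`, a scale `s > 0` and `ε ∈ ℝ`: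
if `(Σ_j F_j^t c_j)/s ≥ −ε t` for every `t ∈ (0,1]`, then `(Σ_j log F_j · c_j)/s ≥ −ε`.
By `Σ c = 0`, `Σ_j F_j^t c_j = Σ_j (F_j^t − 1) c_j`; divide by `t > 0`; `(F^t − 1)/t → log F`
as `t → 0⁺`; finite sums and `≤` pass to the limit along `𝓝[>] 0`. [folklore] -/
theorem stub_schoenbergLimit :
    ∀ (ι : Type) [Fintype ι] (F c : ι → ℝ) (s : ℝ), 0 < s → (∀ j, 0 < F j) → ∑ j, c j = 0 →
      ∀ ε : ℝ, (∀ t : ℝ, 0 < t → t ≤ 1 → -(ε * t) ≤ (∑ j, F j ^ t * c j) / s) →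
        -ε ≤ (∑ j, Real.log (F j) * c j) / s := by
  intro ι _ F c s _ hF hc ε h
  have hlim : Tendsto (fun t : ℝ => (∑ j, (F j ^ t - 1) / t * c j) / s) (𝓝[>] 0)
      (𝓝 ((∑ j, Real.log (F j) * c j) / s)) :=
    (tendsto_finsetSum _ fun j _ => (tendsto_rpow_sub_one_div_nhdsGT (hF j)).mul_const _).div_const
      s
  refine ge_of_tendsto hlim ?_
  filter_upwards [Ioc_mem_nhdsGT (zero_lt_one' ℝ)] with t ht
  obtain ⟨ht0, ht1⟩ := ht
  have key := h t ht0 ht1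
  have e : ∑ j, (F j ^ t - 1) / t * c j = (∑ j, F j ^ t * c j) / t := by
    have e' : ∑ j, (F j ^ t - 1) / t * c j = (∑ j, F j ^ t * c j) / t - (∑ j, c j) / t := by
      rw [Finset.sum_div, Finset.sum_div, ← Finset.sum_sub_distrib]
      exact Finset.sum_congr rfl fun j _ => by ring
    rw [e', hc, zero_div, sub_zero]
  rw [e, div_right_comm, le_div_iff₀ ht0, neg_mul]
  exact key

end Summit.AtomisticToContinuum.BoseEinsteinCondensation.Theorems
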